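import Literature.AlgebraicGeometry.Motives.JacobianNormAdjointOfNormPullback
import Literature.AlgebraicGeometry.Motives.JacobianNormPullbackWeilDivOfLeaves
import Literature.AlgebraicGeometry.Motives.AbelianVarietyPullbackWeilDivInverseOfTranslate
import Literature.AlgebraicGeometry.Motives.AbelianVarietyPullbackWeilDivisorTranslationClass
import Literature.AlgebraicGeometry.Motives.AbelianVarietyWeilDivisorClassPullbackDegree
import Literature.AlgebraicGeometry.Motives.JacobianAbelJacobiSumGaloisPullback
import Literature.AlgebraicGeometry.Motives.GaloisCoverPointDivisorPullback
import Literature.AlgebraicGeometry.Motives.JacobianStepOneOfLeaves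
import Literature.AlgebraicGeometry.Motives.JacobianStepOneTransport
import Literature.AlgebraicGeometry.Motives.JacobianBrillNoetherLocusSymmetric
import Literature.AlgebraicGeometry.Motives.AbelianVarietySimpleOfIsogenyAnyField
import Literature.AlgebraicGeometry.Motives.VarietiesGeometricallyIntegralProofs
import Literature.AlgebraicGeometry.Motives.VarietiesProperProofs
import Literature.AlgebraicGeometry.Motives.SepQuotientPieces
import HarnessLib

/-!
# (F-P2) `Nm_p` / `p^*` are Weil-pairing adjoint for a Galois cover of complex curves — from exactly three leaves
# (Lange, *Abelian Varieties over the Complex Numbers*, Lemma 4.4.4 / Cor. 4.4.5; Milne, *Jacobian Varieties*, §6)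

Topic `Literature/AlgebraicGeometry/Motives`, namespace `Literature.AlgebraicGeometry.Motives.Jacobian`.  PROOF FILE (theorems only;
no definition, no named fact, no instance, no `sorry`).  GLUE III of the G4 road of the cell `hodgecm-mathlib` (D-0151; crux HLiu418 =
stmt-HodgeConjecture-24832; the G4 skeleton v7 of 2026-08-30 made a tree theorem): the named statement
`Jacobian.galoisCover_pullback_isWeilPairingAdjoint_norm` ((F-P2): for a Galois cover `p : X → Y = X∕Δ` of smooth projective complex
curves, `Nm_p : J_X → J_Y` and `t = p^* : J_Y → J_X` are adjoint for the Weil pairings of principal polarisations given by Riemann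
theta divisors) FOLLOWS FROM EXACTLY THREE STATEMENTS ABOUT A SINGLE SMOOTH PROJECTIVE COMPLEX CURVE `C` with a Jacobian `𝒥`
(in the universal-property sense of `Motives/Jacobian`) and a base point `P ∈ C(ℂ)`:

* `hAbel` — ABEL'S THEOREM in Abel–Jacobi-sum currency: `aj_P(E) = aj_P(F)` for linearly equivalent `E ∼ F`
  (`Jacobian.ajSum`, `Motives/JacobianAbelJacobiSum`);
* `hopen` — GENERIC JACOBI INVERSION WITH UNIQUENESS: on a dense open of `J` every point is `Σ_{j<g} α_P(τ_j)` for an injective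
  `g`-tuple `τ` of points of `C`, unique up to permutation (`g = dim J`; the socket `hopen` of ★ `exists_open_ajSum_classPullback_shear_of_leaves`
  at `r = dim J − 1`, verbatim);
* `hmult` — MULTIPLICITY ONE: for an effective `Θ₀` with support `W̃_{g−1}(P)` which is a principal polarisation divisor, on a dense
  open of `J` the sheared pull-back `ι_a^* Θ₀` (`ι_a = t_a ∘ (−1) ∘ α_P`) has order `≤ 1` at every point of `C` (the socket `hmult`,
  verbatim).

Everything else is ★ and is composed here exactly as in the cell's skeleton: GLUE II `…_of_normPullback_weilDiv` ∘ GLUE I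
`weilDiv_map_linEquiv_pullback_weilDiv_of_leaves`, whose leaves are fed by ★ ramification (`CurvePlaces.ordAt_pullback_eq_card_stabilizer_mul_of_isSmoothProjective`,
SGA 1 V / Hartshorne IV.2), ★ naturality `ajSum_pullback_eq_map_of_pin` (LR22 Prop. 3.5.1), ★ degree zero of translation classes
`AbelianVariety.degree_classPullback_weilDiv_eq_zero` (Mumford §8 (iv)), ★ Step I transport `exists_open_ajSum_classPullback_translate_of_leaves`
∘ ★ `exists_open_ajSum_classPullback_shear_of_leaves` (Lange Lemma 4.4.4 Step I, Milne Lemma 6.7) with ★ `exists_preimage_neg_brillNoetherLocus_eq`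
(symmetry of `W̃_{g−1}`), ★ `aj_classPullback_weilDiv_eq_inv_of_translate` (Cor. 4.4.5), and `1 ≤ dim J_X` from ★ `t ≫ Nm_p = |Δ| • 𝟙_{J_Y}`.

* `one_le_dim_of_comp_pushforward` — `1 ≤ dim J_Y ⇒ 1 ≤ dim J_X` for a Galois cover (`t ≫ Nm_p = |Δ| • 𝟙`, so `dim J_Y ≤ dim J_X`);
* `exists_open_ajSum_classPullback_translate_of_three_leaves` — Step I (3a′) for one curve from `hAbel`∕`hopen`∕`hmult`;
* **`galoisCover_pullback_isWeilPairingAdjoint_norm_of_three_leaves`** — (F-P2) from the three leaves (quantified over all curves).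

COUNT-NEUTRAL capital (HC_CM is proved only modulo the 7 printed citations until rung 0 closes).

## References
* [Lange2023AbelianVarietiesComplex] H. Lange, *Abelian Varieties over the Complex Numbers* (2023), §4.4.2 Lemma 4.4.4, Cor. 4.4.5; §4.5.2.
* [Milne1986JacobianVarieties] J. S. Milne, *Jacobian Varieties* (1986), §6 Lemma 6.7, Thm. 6.6, Prop. 6.9.
* [LangeRodriguez2022] H. Lange, R. Rodríguez, *Decomposition of Jacobians by Prym Varieties* (2022), §3.2.1, §3.5.1 Prop. 3.5.1.
-/

set_option autoImplicit false

noncomputable section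

open CategoryTheory AlgebraicGeometry

namespace Literature.AlgebraicGeometry.Motives

namespace Jacobian

/-! ## §1 `1 ≤ dim J_X` for the covering curve -/

/-- **`1 ≤ dim J_Y ⇒ 1 ≤ dim J_X` for a Galois cover `p : X → Y`** with `t = p^*` (`Nm_p ≫ t = Σ_δ δ_*`): ★ `t ≫ Nm_p = |Δ| • 𝟙_{J_Y}`
(`comp_pushforward_eq_card_zsmul`, LR22 §3.2.1) makes `t` quasi-finite onto its image, so `dim J_Y ≤ dim J_X`
(★ `AbelianVariety.dim_le_of_comp_eq_nsmul_id`). [cite: LangeRodriguez2022, §3.2.1 (pp. 46–47, Nm_f ∘ f^* = d_J) and §3.5.1 Prop. 3.5.1 (p. 65)] -/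
theorem one_le_dim_of_comp_pushforward {X Y : SchemeOver ℂ} (𝒥X : Jacobian X) (𝒥Y : Jacobian Y) (hdim : 1 ≤ 𝒥Y.J.dim)
    {Δ : Type} [Group Δ] [Fintype Δ] (act : Δ →* Aut X) (p : X ⟶ Y) (hp : IsSepQuotient (fun δ : Δ => act δ) p)
    (c : AlgPoints X ℂ) (t : 𝒥Y.J ⟶ 𝒥X.J) (ht : 𝒥X.pushforward 𝒥Y p ≫ t = ∑ δ : Δ, 𝒥X.pushforward 𝒥X (act δ).hom) :
    1 ≤ 𝒥X.J.dim := by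
  have hc := 𝒥X.comp_pushforward_eq_card_zsmul 𝒥Y (fun δ : Δ => act δ) p hp c t ht
  rw [natCast_zsmul] at hc
  exact hdim.trans (AbelianVariety.dim_le_of_comp_eq_nsmul_id Fintype.card_ne_zero hc)

/-! ## §2 Step I (3a′) for one curve, from the three leaves -/

/-- **Step I in Abel–Jacobi currency from the three leaves**: for a smooth projective complex curve `C`, a Jacobian `𝒥` with
`1 ≤ dim J`, a base point `c`, and a Riemann theta divisor `Θ` which is a principal polarisation divisor, there are a dense open
`U ⊆ J` and `κ ∈ J(ℂ)` with `aj_c(α_c^♮(t_x^*Θ)) = κ · x⁻¹` for every `x ∈ J(ℂ)` with `x ∈ U` — ★ transport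
`exists_open_ajSum_classPullback_translate_of_leaves` fed with ★ `exists_open_ajSum_classPullback_shear_of_leaves` (at `r = dim J − 1`,
leaves `hopen`, `hmult`, `hAbel`) and ★ `exists_preimage_neg_brillNoetherLocus_eq` (leaf `hAbel`).
[cite: Lange2023AbelianVarietiesComplex, §4.4.2 Lemma 4.4.4 and Cor. 4.4.5] [cite: Milne1986JacobianVarieties, §6 Lemma 6.7] -/
theorem exists_open_ajSum_classPullback_translate_of_three_leaves {C : SchemeOver ℂ} [IsIntegral C.left] [IsLocallyNoetherian C.left]
    (𝒥 : Jacobian C) (hC : IsSmoothProjective 1 C) (hdim : 1 ≤ 𝒥.J.dim) (c : AlgPoints C ℂ)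
    (hAbel : ∀ E F : CartierDivisor C.left, E.LinEquiv F → 𝒥.ajSum c E = 𝒥.ajSum c F)
    (hopen : ∃ U₁ : 𝒥.J.X.left.Opens, (U₁ : Set 𝒥.J.X.left).Nonempty ∧
      ∀ a : 𝒥.J.Points ℂ, a.pt ∈ U₁ → ∃ τ : Fin (𝒥.J.dim - 1 + 1) → AlgPoints C ℂ, Function.Injective τ ∧
        (∏ j : Fin (𝒥.J.dim - 1 + 1), τ j ≫ 𝒥.abelJacobi c) = a ∧
        ∀ τ' : Fin (𝒥.J.dim - 1 + 1) → AlgPoints C ℂ, (∏ j : Fin (𝒥.J.dim - 1 + 1), τ' j ≫ 𝒥.abelJacobi c) = a →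
          ∃ σ : Equiv.Perm (Fin (𝒥.J.dim - 1 + 1)), τ' = τ ∘ σ)
    (hmult : ∀ {Θ₀ : CartierDivisor 𝒥.J.X.left}, Θ₀.IsEffective → (Θ₀.nonvanishing 1)ᶜ = 𝒥.brillNoetherLocus c (𝒥.J.dim - 1) →
      𝒥.J.IsPrincipalPolarizationDivisor Θ₀ →
      ∃ U₂ : 𝒥.J.X.left.Opens, (U₂ : Set 𝒥.J.X.left).Nonempty ∧
        ∀ a : 𝒥.J.Points ℂ, a.pt ∈ U₂ →
          ∀ hav : Θ₀.Avoids (((𝒥.abelJacobi c).left ≫ AbelianVariety.Hom.toSchemeHom ((-1 : ℤ) • 𝟙 𝒥.J) ≫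
              (𝒥.J.translation a).left) (genericPoint C.left)),
          ∀ Q : AlgPoints C ℂ,
            (Θ₀.pullbackAvoiding ((𝒥.abelJacobi c).left ≫ AbelianVariety.Hom.toSchemeHom ((-1 : ℤ) • 𝟙 𝒥.J) ≫
              (𝒥.J.translation a).left) hav).ordAt Q.pt ≤ 1)
    {Θ : CartierDivisor 𝒥.J.X.left} (h1 : 𝒥.IsRiemannThetaDivisor Θ) (h2 : 𝒥.J.IsPrincipalPolarizationDivisor Θ) :
    ∃ U : 𝒥.J.X.left.Opens, (U : Set 𝒥.J.X.left).Nonempty ∧ ∃ κ : 𝒥.J.Points ℂ,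
      ∀ x : 𝒥.J.Points ℂ, x.pt ∈ U →
        𝒥.ajSum c ((Θ.pullback (𝒥.J.translation x).left).classPullback (𝒥.abelJacobi c).left) = κ * x⁻¹ := by
  haveI := hC.smoothOfRelativeDimension
  haveI : IsProper C.hom := IsSmoothProjective.isProper_holds hC
  exact exists_open_ajSum_classPullback_translate_of_leaves hC 𝒥 hdim c
    (fun Θ₀ h0 hsupp hpp => exists_open_ajSum_classPullback_shear_of_leaves 𝒥 c (𝒥.J.dim - 1) h0 hsupp
      hopen (hmult h0 hsupp hpp) hAbel)
    (exists_preimage_neg_brillNoetherLocus_eq 𝒥 hC c hAbel) (fun h => hAbel _ _ h) h1 h2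

/-! ## §3 (F-P2) from the three leaves -/

/-- **(F-P2) `Jacobian.galoisCover_pullback_isWeilPairingAdjoint_norm` FROM EXACTLY THREE LEAVES** — Abel's theorem in
Abel–Jacobi-sum currency (`hAbel`), generic Jacobi inversion with uniqueness (`hopen`) and multiplicity one of the sheared theta
pull-back (`hmult`), each for every smooth projective complex curve with a Jacobian of dimension `≥ 1` and every base point.  The
composition is the cell's G4 skeleton: GLUE II ★ `galoisCover_pullback_isWeilPairingAdjoint_norm_of_normPullback_weilDiv` ∘ GLUE I ★
`weilDiv_map_linEquiv_pullback_weilDiv_of_leaves`, with ramification ★ `CurvePlaces.ordAt_pullback_eq_card_stabilizer_mul_of_isSmoothProjective`,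
the orbit clause ★ `IsSepQuotient.exists_map_act_eq_of_map_eq`, naturality ★ `ajSum_pullback_eq_map_of_pin`, degree zero ★
`AbelianVariety.degree_classPullback_weilDiv_eq_zero`, Cor. 4.4.5 ★ `aj_classPullback_weilDiv_eq_inv_of_translate` over §2, the linear
equivalence of theta translates ★ `exists_pullback_weilDiv_linEquiv_weilDiv`, and §1 for `1 ≤ dim J_X`.
[cite: Lange2023AbelianVarietiesComplex, §4.4.2 Lemma 4.4.4 and Cor. 4.4.5, §4.5.2] [cite: Milne1986JacobianVarieties, §6 Lemma 6.7, Thm. 6.6 and Prop. 6.9]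
[cite: LangeRodriguez2022, §3.5.1 Prop. 3.5.1 (p. 65)] -/
theorem galoisCover_pullback_isWeilPairingAdjoint_norm_of_three_leaves
    (hAbel : ∀ {C : SchemeOver ℂ} [IsIntegral C.left] [IsLocallyNoetherian C.left] (𝒥 : Jacobian C),
      IsSmoothProjective 1 C → ∀ (c : AlgPoints C ℂ) (E F : CartierDivisor C.left), E.LinEquiv F → 𝒥.ajSum c E = 𝒥.ajSum c F)
    (hopen : ∀ {C : SchemeOver ℂ} [IsIntegral C.left] [IsLocallyNoetherian C.left] (𝒥 : Jacobian C),
      IsSmoothProjective 1 C → 1 ≤ 𝒥.J.dim → ∀ c : AlgPoints C ℂ,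
      ∃ U₁ : 𝒥.J.X.left.Opens, (U₁ : Set 𝒥.J.X.left).Nonempty ∧
        ∀ a : 𝒥.J.Points ℂ, a.pt ∈ U₁ → ∃ τ : Fin (𝒥.J.dim - 1 + 1) → AlgPoints C ℂ, Function.Injective τ ∧
          (∏ j : Fin (𝒥.J.dim - 1 + 1), τ j ≫ 𝒥.abelJacobi c) = a ∧
          ∀ τ' : Fin (𝒥.J.dim - 1 + 1) → AlgPoints C ℂ, (∏ j : Fin (𝒥.J.dim - 1 + 1), τ' j ≫ 𝒥.abelJacobi c) = a →
            ∃ σ : Equiv.Perm (Fin (𝒥.J.dim - 1 + 1)), τ' = τ ∘ σ)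
    (hmult : ∀ {C : SchemeOver ℂ} [IsIntegral C.left] [IsLocallyNoetherian C.left] (𝒥 : Jacobian C),
      IsSmoothProjective 1 C → 1 ≤ 𝒥.J.dim → ∀ (c : AlgPoints C ℂ) {Θ₀ : CartierDivisor 𝒥.J.X.left}, Θ₀.IsEffective →
      (Θ₀.nonvanishing 1)ᶜ = 𝒥.brillNoetherLocus c (𝒥.J.dim - 1) → 𝒥.J.IsPrincipalPolarizationDivisor Θ₀ →
      ∃ U₂ : 𝒥.J.X.left.Opens, (U₂ : Set 𝒥.J.X.left).Nonempty ∧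
        ∀ a : 𝒥.J.Points ℂ, a.pt ∈ U₂ →
          ∀ hav : Θ₀.Avoids (((𝒥.abelJacobi c).left ≫ AbelianVariety.Hom.toSchemeHom ((-1 : ℤ) • 𝟙 𝒥.J) ≫
              (𝒥.J.translation a).left) (genericPoint C.left)),
          ∀ Q : AlgPoints C ℂ,
            (Θ₀.pullbackAvoiding ((𝒥.abelJacobi c).left ≫ AbelianVariety.Hom.toSchemeHom ((-1 : ℤ) • 𝟙 𝒥.J) ≫
              (𝒥.J.translation a).left) hav).ordAt Q.pt ≤ 1) :
    galoisCover_pullback_isWeilPairingAdjoint_norm := by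
  refine galoisCover_pullback_isWeilPairingAdjoint_norm_of_normPullback_weilDiv
    fun X Y hX hY 𝒥X 𝒥Y hdim Δ _ _ act hact p hp ΘX ΘY h1 h2 h3 h4 t ht _ N _ Q => ?_
  -- instances on the two curves
  haveI : IsIntegral X.left := IsSmoothProjective.isIntegral_holds hX
  haveI : IsIntegral Y.left := IsSmoothProjective.isIntegral_holds hY
  haveI := hX.smoothOfRelativeDimension
  haveI := hY.smoothOfRelativeDimension
  haveI : IsProper X.hom := IsSmoothProjective.isProper_holds hX
  haveI : IsProper Y.hom := IsSmoothProjective.isProper_holds hY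
  haveI : IsLocallyNoetherian X.left := inferInstance
  haveI : IsLocallyNoetherian Y.left := inferInstance
  haveI : IsDominant p.left := isDominant_of_surjective_map p
    (IsSepQuotient.surjective_map_of_isProjectiveOver act p hX.isProjectiveOver inferInstance hp)
  have hYh : Order.height (⊤ : Y.left) = 1 := CurvePlaces.height_top_of_smoothCurve Y
  obtain ⟨c⟩ := hX.nonempty_algPoints ℂ
  have hdimX : 1 ≤ 𝒥X.J.dim := one_le_dim_of_comp_pushforward 𝒥X 𝒥Y hdim act p hp c t ht
  -- ramification and the orbit clause of the Galois cover
  have hram := CurvePlaces.ordAt_pullback_eq_card_stabilizer_mul_of_isSmoothProjective hX hY act hact p hp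
  have hfib : ∀ w x : AlgPoints X ℂ, AlgPoints.map p w = AlgPoints.map p x → ∃ δ : Δ, AlgPoints.map (act δ).hom w = x :=
    fun w x h => IsSepQuotient.exists_map_act_eq_of_map_eq act p hX.isProjectiveOver inferInstance hp h
  -- Abel on `X` (base point `c`) and on `Y` (base point `p c`)
  have hlinX : ∀ D E : CartierDivisor X.left, D.LinEquiv E → 𝒥X.ajSum c D = 𝒥X.ajSum c E :=
    fun D E h => hAbel 𝒥X hX c D E h
  have hlinY : ∀ D E : CartierDivisor Y.left, D.LinEquiv E → 𝒥Y.ajSum (AlgPoints.map p c) D = 𝒥Y.ajSum (AlgPoints.map p c) E :=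
    fun D E h => hAbel 𝒥Y hY (AlgPoints.map p c) D E h
  -- Cor. 4.4.5 on `X` and on `Y`, from Step I (§2)
  have hcorX : ∀ x : 𝒥X.J.Points ℂ,
      𝒥X.ajSum c ((𝒥X.J.weilDiv ΘX x).classPullback (𝒥X.abelJacobi c).left) = x⁻¹ := by
    obtain ⟨U, hUne, κ, hU⟩ := exists_open_ajSum_classPullback_translate_of_three_leaves 𝒥X hX hdimX c hlinX
      (hopen 𝒥X hX hdimX c) (fun h0 hs hpp => hmult 𝒥X hX hdimX c h0 hs hpp) h1 h2
    exact AbelianVariety.aj_classPullback_weilDiv_eq_inv_of_translate (𝒥X.abelJacobi c).left (𝒥X.ajSum c)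
      (𝒥X.ajSum_add c) hlinX ΘX hUne κ hU
  have hcorY : ∀ y : 𝒥Y.J.Points ℂ,
      𝒥Y.ajSum (AlgPoints.map p c) ((𝒥Y.J.weilDiv ΘY y).classPullback (𝒥Y.abelJacobi (AlgPoints.map p c)).left) = y⁻¹ := by
    obtain ⟨U, hUne, κ, hU⟩ := exists_open_ajSum_classPullback_translate_of_three_leaves 𝒥Y hY hdim (AlgPoints.map p c) hlinY
      (hopen 𝒥Y hY hdim (AlgPoints.map p c)) (fun h0 hs hpp => hmult 𝒥Y hY hdim (AlgPoints.map p c) h0 hs hpp) h3 h4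
    exact AbelianVariety.aj_classPullback_weilDiv_eq_inv_of_translate (𝒥Y.abelJacobi (AlgPoints.map p c)).left
      (𝒥Y.ajSum (AlgPoints.map p c)) (𝒥Y.ajSum_add (AlgPoints.map p c)) hlinY ΘY hUne κ hU
  -- GLUE I from the leaves
  exact weilDiv_map_linEquiv_pullback_weilDiv_of_leaves 𝒥X 𝒥Y p (𝒥X.pushforward 𝒥Y p) t c
    (𝒥X.abelJacobi_comp_pushforward 𝒥Y p c) ΘX ΘY (𝒥X.ajSum c) (𝒥Y.ajSum (AlgPoints.map p c)) hcorX hcorY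
    (fun E hE => ajSum_pullback_eq_map_of_pin 𝒥X 𝒥Y Δ act hact p hp t ht hram hfib c E hE)
    (fun y => AbelianVariety.degree_classPullback_weilDiv_eq_zero hYh _ ΘY y) hlinX
    (fun y => exists_pullback_weilDiv_linEquiv_weilDiv 𝒥X 𝒥Y p h2.isAmple ΘY y) Q.1

end Jacobian

end Literature.AlgebraicGeometry.Motives

end
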